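import Summits.QuantumFields.GaugeBoot.BootstrapReflectionCutConsistency
import Summits.QuantumFields.GaugeBoot.CubicTorusLinkRPNegativeBetaOdd
import Summits.QuantumFields.GaugeBoot.CubicTorusLinkRPAnyBeta
import Summits.QuantumFields.GaugeBoot.CubicTorusLinkRPTwoDim
import HarnessLib

/-!
# The LINK-reflection cut family of the torus bootstrap along every axis, at every coupling:
# consistent iff `β ≥ 0` for `SU(3)` (and every odd `N`), at every `β` for `SU(2n)`, `U(N)`
# (gauge-boot, L3 ↔ L1)

HONEST FRAMING (cell `pub-gaugeboot`, page 1 of every file): the venture produces certified bounds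
on lattice expectations at stated coupling, gauge group, dimension and torus size; NOT a mass gap,
NOT a continuum limit, NOT a string tension; NOT Yang–Mills-summit-bearing (barriers
`FixedCouplingUltralocality`, `PerturbativeInvisibility`). Structural; it certifies no number; no
certificate of the cell sits at `β < 0`. It says which positivity constraints a TORUS bootstrap may
impose; nothing else.

## Content

The second RP family of the lattice bootstrap (Kazakov–Zheng §3.1; most of the numerical power in
§4) reflects in the hyperplane `x_k = ½` BETWEEN two layers. `BootstrapLinkReflectionPositivity`
typed its cuts along the time axis for `β ≥ 0` (tree S13). The cell's L3 lane settled the positivity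
of the torus Wilson measure on `(ℤ/2Q)^d`, `Q ≥ 2`, along EVERY axis: true for every compact `G` at
`β ≥ 0`, at EVERY `β` for `U(N)`, `SU(2n)` (`CubicTorusLinkRPAnyBeta`), FALSE at every `β < 0` for
`SU(N)`, `N` odd, `3 ≤ N ≤ 2d - 3` (`CubicTorusLinkRPNegativeBetaOdd`). With `rpCuts_sound_iff_suN`
this becomes the operational table of the LINK CUT FAMILY along the axis `k`:

* `midReflectCM k`, `comp_midReflectCM_mem_polyAlgebra` — the reflection `x_k ↦ 1 - x_k` of torus
  configurations (`TiltedRP.configMidReflect` at the cubic frame) as a continuous polynomial-stable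
  map; `midHalfLinks Q k`, `isMidObservable_iff_dependsOn` — the closed half `{1 ≤ x_k ≤ Q}` as a link
  set; `midReflectCM_midReflectCM`, `measurePreserving_midReflectCM_wilson` (every real `β`);
  `midReflectCM_zero_eq_timeReflectCM`, `isPositiveTimeObservable_iff_isMidObservable` — along the
  time axis this is the tree's `Θ` / `IsPositiveTimeObservable`, so `linkRpLevelValuesSuN` of
  `BootstrapLinkReflectionPositivity` is the instance `k = 0` (`linkRpLevelValuesSuN_eq`);
* `reflectionPositiveOn_midReflect_iff` — `ReflectionPositiveOn μ_W (midReflectCM k) (midHalfLinks Q k)`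
  is literally the cell's closed-half link RP statement along `k`;
* ★★★ `linkCuts_sound_iff_suOdd` — `SU(N)`, `N` odd, `3 ≤ N`, `N + 3 ≤ 2d`, `(ℤ/2Q)^d`, `Q ≥ 2`, any
  axis: the link cuts keep the Wilson value feasible at every level for every observable IFF
  `0 ≤ β`; ★★★ `linkCutLevelValues_eventually_eq_empty_suOdd` — at every `β < 0` the word-level SDP
  with link cuts is INFEASIBLE at all large levels, for every objective; ★★★
  `exists_linkCut_neg_of_bootstrap_suOdd` — every solution of the untruncated bootstrap violates a
  link cut; `SU(3)`, `d ≥ 3`: `linkCuts_sound_iff_su3`, `linkCutLevelValues_eventually_eq_empty_su3`,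
  `exists_linkCut_neg_of_bootstrap_su3`, and in the vocabulary of `BootstrapLinkReflectionPositivity`
  ★★★ `linkRpCuts_sound_iff_su3` (time axis);
* ★★ `wilson_mem_linkCutLevelValues_suN` (`β ≥ 0`, every `N`, every axis), `_suEven` (EVERY
  `β`), `linkCut_of_bootstrap_uN` (`U(N)`, every `β`, every solution satisfies every link cut);
  `linkCutLevelValues_subset_Icc_suN` (convergence);
* ★★ `siteCuts_sound_linkCuts_infeasible_su3` — the contrast at `β < 0` (`SU(3)`, `d ≥ 3`): the SITE
  cuts stay sound at every level while the LINK cuts are eventually infeasible.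

What this is NOT: odd tori (no mid-plane frame); `N` odd with `2d < N + 3` at `β < 0`; rates.

References: K. Osterwalder, E. Seiler, Ann. Phys. 110 (1978) 440 §2; V. Kazakov, Z. Zheng,
arXiv:2203.11360 §3.1, §4; P. D. Anderson, M. Kruczenski, Nucl. Phys. B 921 (2017) 702. Folklore.
-/

noncomputable section

open MeasureTheory Filter Topology NormedSpace
open scoped ComplexOrder ComplexConjugate
open Literature.MathematicalPhysics.QuantumFieldTheory (LatticeRep Site Edge GaugeConfig IsPositiveTimeObservable
  wilsonAction wilsonMeasure isProbabilityMeasure_wilsonMeasure)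

namespace Summit.QuantumFields.GaugeBoot

open TiltedRP (cubicUnit cubicAxisReflect cubicAxisCoord configMidReflect midLinkMap IsMidObservable IsMidPosLink
  isSiteFrame_cubicTorus)

/-! ## The link reflection along the axis `k` as a continuous polynomial-stable involution -/

section Reflection

variable {d L : ℕ} {G : Type*} [Group G] [TopologicalSpace G] [IsTopologicalGroup G]

/-- **The link (mid-plane) reflection `Θ_k` of torus configurations along the axis `k`**
(`x_k ↦ 1 - x_k`; `k`-links crossing the planes reversed and inverted): the frame theory's
`configMidReflect` at the cubic frame `(e_k, x_k ↦ -x_k)`, as a continuous self-map. [folklore] -/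
def midReflectCM (k : Fin d) : C(GaugeConfig d L G, GaugeConfig d L G) where
  toFun := configMidReflect (cubicUnit d L) k (cubicAxisReflect d L k)
  continuous_toFun := TiltedRP.continuous_configMidReflect (G := G) (cubicUnit d L) k (cubicAxisReflect d L k)

/-- `midReflectCM k` is `configMidReflect (cubicUnit d L) k (cubicAxisReflect d L k)`. -/
@[simp] theorem midReflectCM_apply (k : Fin d) (U : GaugeConfig d L G) :
    midReflectCM k U = configMidReflect (cubicUnit d L) k (cubicAxisReflect d L k) U := rfl

/-- **Along the time axis `Θ_0` is the tree's `GaugeConfig.timeReflect`** (`timeReflectCM` of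
`BootstrapLinkReflectionPositivity`; `configMidReflect_cubicUnit_zero`). -/
theorem midReflectCM_zero_eq_timeReflectCM [NeZero d] :
    (midReflectCM 0 : C(GaugeConfig d L G, GaugeConfig d L G)) = timeReflectCM := by
  ext U e
  rw [midReflectCM_apply, TiltedRP.configMidReflect_cubicUnit_zero, timeReflectCM_apply]

variable (r : LatticeRep G)

/-- **The polynomial observables are stable under `Θ_k`** (a reversed link contributes
`ρ(U⁻¹) = ρ(U)ᴴ`: entries `±` entries). [folklore] -/
theorem comp_midReflectCM_mem_polyAlgebra (k : Fin d) {f : C(GaugeConfig d L G, ℝ)}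
    (hf : f ∈ polyAlgebra (ι := Edge d L) r) :
    f.comp (midReflectCM k) ∈ polyAlgebra (ι := Edge d L) r := by
  have h : polyAlgebra (ι := Edge d L) r ≤ (polyAlgebra (ι := Edge d L) r).comap
      (ContinuousMap.compRightAlgHom ℝ ℝ (midReflectCM (G := G) (d := d) (L := L) k)) := by
    refine Algebra.adjoin_le ?_
    rintro _ (⟨⟨e, a, b⟩, rfl⟩ | ⟨⟨e, a, b⟩, rfl⟩)
    · change (reEntry r e a b).comp (midReflectCM k) ∈ polyAlgebra (ι := Edge d L) r
      by_cases he : e.2 = k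
      · have : (reEntry r e a b).comp (midReflectCM (G := G) k) =
            reEntry r (midLinkMap (cubicUnit d L) k (cubicAxisReflect d L k) e) b a := by
          ext U
          simp only [ContinuousMap.comp_apply, midReflectCM_apply, reEntry_apply, TiltedRP.configMidReflect,
            he, if_true]
          exact (rho_inv_apply_re_im r _ a b).1
        rw [this]
        exact reEntry_mem r _ b a
      · have : (reEntry r e a b).comp (midReflectCM (G := G) k) =
            reEntry r (midLinkMap (cubicUnit d L) k (cubicAxisReflect d L k) e) a b := by
          ext U
          simp only [ContinuousMap.comp_apply, midReflectCM_apply, reEntry_apply, TiltedRP.configMidReflect,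
            he, if_false]
        rw [this]
        exact reEntry_mem r _ a b
    · change (imEntry r e a b).comp (midReflectCM k) ∈ polyAlgebra (ι := Edge d L) r
      by_cases he : e.2 = k
      · have : (imEntry r e a b).comp (midReflectCM (G := G) k) =
            -imEntry r (midLinkMap (cubicUnit d L) k (cubicAxisReflect d L k) e) b a := by
          ext U
          simp only [ContinuousMap.comp_apply, midReflectCM_apply, imEntry_apply, TiltedRP.configMidReflect,
            he, if_true, ContinuousMap.neg_apply]
          exact (rho_inv_apply_re_im r _ a b).2
        rw [this]
        exact Subalgebra.neg_mem _ (imEntry_mem r _ b a)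
      · have : (imEntry r e a b).comp (midReflectCM (G := G) k) =
            imEntry r (midLinkMap (cubicUnit d L) k (cubicAxisReflect d L k) e) a b := by
          ext U
          simp only [ContinuousMap.comp_apply, midReflectCM_apply, imEntry_apply, TiltedRP.configMidReflect,
            he, if_false]
        rw [this]
        exact imEntry_mem r _ a b
  exact h hf

variable {Q : ℕ}

/-- **`Θ_k` is an involution** on the even torus `(ℤ/2Q)^d`, `Q ≥ 2` (the cubic site frame,
`isSiteFrame_cubicTorus`). -/
theorem midReflectCM_midReflectCM (hQ : 2 ≤ Q) (k : Fin d)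
    (U : GaugeConfig d (2 * Q) G) : midReflectCM k (midReflectCM k U) = U :=
  (isSiteFrame_cubicTorus d hQ k).configMidReflect_configMidReflect U

omit [Group G] [TopologicalSpace G] [IsTopologicalGroup G] in
/-- **The links of the closed half `{1 ≤ x_k ≤ Q}`** of the mid-plane reflection along `k` (both
endpoints in the half: the frame theory's positive links `IsMidPosLink`). [folklore] -/
def midHalfLinks (Q : ℕ) (k : Fin d) : Set (Edge d (2 * Q)) :=
  {l | IsMidPosLink (cubicUnit d (2 * Q)) Q (cubicAxisCoord d (2 * Q) k) l}

omit [Group G] [TopologicalSpace G] [IsTopologicalGroup G] in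
/-- `IsMidObservable` (frame theory) says exactly `DependsOn F (midHalfLinks Q k)`. -/
theorem isMidObservable_iff_dependsOn {α : Type*} (Q : ℕ) (k : Fin d) (F : GaugeConfig d (2 * Q) G → α) :
    IsMidObservable (cubicUnit d (2 * Q)) Q (cubicAxisCoord d (2 * Q) k) F ↔
      DependsOn F (midHalfLinks (d := d) Q k) :=
  ⟨fun h _ _ hUV => h _ _ fun l hl => hUV l hl, fun h _ _ hUV => h fun l hl => hUV l hl⟩

omit [Group G] [TopologicalSpace G] [IsTopologicalGroup G] in
/-- **Along the time axis the closed half is the tree's positive-time half**: the tree's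
`IsPositiveTimeObservable` (`1 ≤ x_0 ≤ L/2` at both endpoints, `L = 2Q`) is `IsMidObservable` for
the axis `0`. -/
theorem isPositiveTimeObservable_iff_isMidObservable [NeZero d] {α : Type*} (F : GaugeConfig d (2 * Q) G → α) :
    IsPositiveTimeObservable F ↔ IsMidObservable (cubicUnit d (2 * Q)) Q (cubicAxisCoord d (2 * Q) 0) F := by
  have h2 : 2 * Q / 2 = Q := Nat.mul_div_cancel_left Q two_pos
  constructor
  · intro h U V hUV
    refine h U V fun e h1 h1' h3 h3' => hUV e ⟨⟨h1, ?_⟩, ⟨?_, ?_⟩⟩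
    · simpa [h2] using h1'
    · simpa [Site.shift, TiltedRP.cubicUnit] using h3
    · simpa [h2, Site.shift, TiltedRP.cubicUnit] using h3'
  · intro h U V hUV
    refine h U V fun l hl => hUV l hl.1.1 ?_ ?_ ?_
    · simpa [h2] using hl.1.2
    · simpa [Site.shift, TiltedRP.cubicUnit] using hl.2.1
    · simpa [h2, Site.shift, TiltedRP.cubicUnit] using hl.2.2

end Reflection

/-! ## `Θ_k` preserves the torus Wilson measure; the packaged link RP statement -/

section Wilson

-- `G : Type` (universe 0) as in the cell's cubic-torus RP files (`CubicTorusRP`).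
variable {d Q N : ℕ} [NeZero Q] {G : Type} [Group G] [TopologicalSpace G] [IsTopologicalGroup G]
  [CompactSpace G] [MeasurableSpace G] [BorelSpace G] [SecondCountableTopology G]
  (ρ : G →* Matrix (Fin N) (Fin N) ℂ)

/-- **`Θ_k` preserves the torus Wilson measure at EVERY real `β`** (`(ℤ/2Q)^d`, `Q ≥ 2`, continuous
`ρ`; `cubicTorus_integral_comp_configMidReflect` + `measurePreserving_of_forall_integral_comp_eq`). -/
theorem measurePreserving_midReflectCM_wilson (hρ : Continuous ρ) (hQ : 2 ≤ Q) (k : Fin d) (β : ℝ) :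
    MeasurePreserving (midReflectCM k) (wilsonMeasure (d := d) (L := 2 * Q) ρ β)
      (wilsonMeasure (d := d) (L := 2 * Q) ρ β) := by
  haveI : IsProbabilityMeasure (wilsonMeasure (d := d) (L := 2 * Q) ρ β) :=
    isProbabilityMeasure_wilsonMeasure (ρ := ρ) hρ β
  exact measurePreserving_of_forall_integral_comp_eq (midReflectCM (G := G) k).continuous.measurable
    fun F hF => TiltedRP.cubicTorus_integral_comp_configMidReflect ρ hQ k hρ β hF

omit [SecondCountableTopology G] in
/-- **`ReflectionPositiveOn μ_W (Θ_k) (midHalfLinks Q k)` is the cell's closed-half LINK RP statement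
along `k`** (the hypothesis/conclusion shape of `cubicTorus_linkRP_suN`, `cubicTorus_linkRP_su3_iff`,
`cubicTorus_linkRP_suN_iff_of_odd`, …). -/
theorem reflectionPositiveOn_midReflect_iff (β : ℝ) (k : Fin d) :
    ReflectionPositiveOn (wilsonMeasure (d := d) (L := 2 * Q) ρ β) (midReflectCM k) (midHalfLinks Q k) ↔
      ∀ F : GaugeConfig d (2 * Q) G → ℂ, Measurable F → (∃ C : ℝ, ∀ U, ‖F U‖ ≤ C) →
        IsMidObservable (cubicUnit d (2 * Q)) Q (cubicAxisCoord d (2 * Q) k) F →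
        0 ≤ ∫ U, conj (F (configMidReflect (cubicUnit d (2 * Q)) k (cubicAxisReflect d (2 * Q) k) U)) *
          F U ∂(wilsonMeasure (d := d) (L := 2 * Q) ρ β) :=
  ⟨fun h F hF hFb hFo => h F hF hFb ((isMidObservable_iff_dependsOn Q k F).1 hFo),
    fun h F hF hFb hFS => h F hF hFb ((isMidObservable_iff_dependsOn Q k F).2 hFS)⟩

end Wilson

/-! ## The link cut family of the `SU(N)` / `U(N)` torus bootstrap along the axis `k` -/

section Unitary

open Literature.MathematicalPhysics.QuantumLattice

variable {d Q : ℕ} [NeZero Q] (N : ℕ) (β : ℝ)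

/-- **The level-`n` feasible values of `P` with the LINK cuts along the axis `k`** (`SU(N)` word SDP
on `(ℤ/2Q)^d`: moment positivity, loop equations, and `0 ≤ φ ((v ∘ Θ_k) · v)` for every level-`n`
test function `v` of the closed half `{1 ≤ x_k ≤ Q}`). [folklore] -/
def linkCutLevelValuesSuN (k : Fin d) (n : ℕ)
    (P : C(GaugeConfig d (2 * Q) (Matrix.specialUnitaryGroup (Fin N) ℂ), ℝ)) : Set ℝ :=
  rpCutLevelValuesSuN N β (midReflectCM k) (midHalfLinks Q k) n P

/-- **The time-axis instance is `linkRpLevelValuesSuN` of `BootstrapLinkReflectionPositivity`.** -/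
theorem linkRpLevelValuesSuN_eq [NeZero d] (n : ℕ)
    (P : C(GaugeConfig d (2 * Q) (Matrix.specialUnitaryGroup (Fin N) ℂ), ℝ)) :
    linkRpLevelValuesSuN (d := d) (L := 2 * Q) N β n P = linkCutLevelValuesSuN N β 0 n P := by
  ext t
  simp only [linkRpLevelValuesSuN, linkCutLevelValuesSuN, rpCutLevelValuesSuN, Set.mem_setOf_eq,
    midReflectCM_zero_eq_timeReflectCM, isPositiveTimeObservable_iff_isMidObservable, isMidObservable_iff_dependsOn]

/-- ★★ **The link cut SDP bounds converge to the Wilson value** (every axis, every real `β`). -/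
theorem linkCutLevelValues_subset_Icc_suN (k : Fin d)
    {P : C(GaugeConfig d (2 * Q) (Matrix.specialUnitaryGroup (Fin N) ℂ), ℝ)}
    (hP : P ∈ polyAlgebra (ι := Edge d (2 * Q)) (fundamentalLatticeRep N)) {ε : ℝ} (hε : 0 < ε) :
    ∀ᶠ n in atTop, linkCutLevelValuesSuN N β k n P ⊆
      Set.Icc (∫ U, P U ∂(wilsonMeasure (fundamentalRep (Fin N)) β) - ε)
        (∫ U, P U ∂(wilsonMeasure (fundamentalRep (Fin N)) β) + ε) :=
  rpCutLevelValues_subset_Icc_suN hP hε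

/-! ### Sound: `β ≥ 0` (every `N`); every `β` for `SU(2n)`, `U(N)` -/

/-- ★★ **`β ≥ 0`, every `N`, every axis: the Wilson value satisfies the link cuts at every level**
(`cubicTorus_linkRP_suN`). [folklore] -/
theorem wilson_mem_linkCutLevelValues_suN (hQ : 2 ≤ Q) (k : Fin d) (hβ : 0 ≤ β) (n : ℕ)
    (P : C(GaugeConfig d (2 * Q) (Matrix.specialUnitaryGroup (Fin N) ℂ), ℝ)) :
    ∫ U, P U ∂(wilsonMeasure (fundamentalRep (Fin N)) β) ∈ linkCutLevelValuesSuN N β k n P :=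
  wilson_mem_rpCutLevelValues_suN
    ((reflectionPositiveOn_midReflect_iff (fundamentalRep (Fin N)) β k).2
      (TiltedRP.cubicTorus_linkRP_suN hQ k hβ)) n P

/-- ★★ **`SU(M)`, `M` even, EVERY real `β`, every axis: the link cuts are sound at every level**
(`cubicTorus_linkRP_suEven_anyBeta`). [folklore] -/
theorem wilson_mem_linkCutLevelValues_suEven {M : ℕ} (hM : Even M) (hQ : 2 ≤ Q) (k : Fin d) (n : ℕ)
    (P : C(GaugeConfig d (2 * Q) (Matrix.specialUnitaryGroup (Fin M) ℂ), ℝ)) :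
    ∫ U, P U ∂(wilsonMeasure (fundamentalRep (Fin M)) β) ∈ linkCutLevelValuesSuN M β k n P :=
  wilson_mem_rpCutLevelValues_suN
    ((reflectionPositiveOn_midReflect_iff (fundamentalRep (Fin M)) β k).2
      (TiltedRP.cubicTorus_linkRP_suEven_anyBeta hM hQ k β)) n P

/-- ★★ **`U(N)`, EVERY real `β`, every axis: every solution of the untruncated `U(N)` torus bootstrap
satisfies every link cut** (`cubicTorus_linkRP_uN_anyBeta`; `β ≥ 0` along the time axis was
`linkRP_of_bootstrap_uN`). [folklore] -/
theorem linkCut_of_bootstrap_uN (hQ : 2 ≤ Q) (k : Fin d)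
    {φ : C(GaugeConfig d (2 * Q) (Matrix.unitaryGroup (Fin N) ℂ), ℝ) →ₗ[ℝ] ℝ} (h1 : φ 1 = 1)
    (hpos : ∀ a ∈ polyAlgebra (ι := Edge d (2 * Q)) (unitaryFundamentalLatticeRep N), 0 ≤ φ (a * a))
    (hφ : IsSDFunctional (unitaryFundamentalLatticeRep N) (uExp N)
      (fun _ => wilsonAction (unitaryFundamentalRep (Fin N) ℂ)) β φ)
    {f : C(GaugeConfig d (2 * Q) (Matrix.unitaryGroup (Fin N) ℂ), ℝ)}
    (hf : f ∈ polyAlgebra (ι := Edge d (2 * Q)) (unitaryFundamentalLatticeRep N))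
    (hfo : IsMidObservable (cubicUnit d (2 * Q)) Q (cubicAxisCoord d (2 * Q) k) (⇑f)) :
    0 ≤ φ (f.comp (midReflectCM k) * f) :=
  rpCut_of_bootstrap_uN
    ((reflectionPositiveOn_midReflect_iff (unitaryFundamentalRep (Fin N) ℂ) β k).2
      (TiltedRP.cubicTorus_linkRP_uN_anyBeta hQ k β))
    (fun _ hg => comp_midReflectCM_mem_polyAlgebra _ k hg) h1 hpos hφ hf
    ((isMidObservable_iff_dependsOn Q k _).1 hfo)

/-! ### `N` odd: consistent IFF `β ≥ 0` -/

variable {N}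

/-- ★★★ **THE LINK CUTS ARE CONSISTENT WITH THE `SU(N)` TORUS BOOTSTRAP IFF `β ≥ 0`** for `N` odd,
`3 ≤ N`, `N + 3 ≤ 2d` (e.g. `SU(3)` in `d ≥ 3`), on `(ℤ/2Q)^d`, `Q ≥ 2`, along any axis `k`: the
Wilson value of every observable is feasible with the link cuts at every level iff `0 ≤ β`
(`rpCuts_sound_iff_suN` + `cubicTorus_linkRP_suN_iff_of_odd`). [folklore] -/
theorem linkCuts_sound_iff_suOdd (hQ : 2 ≤ Q) (k : Fin d) (hN : Odd N) (h3 : 3 ≤ N)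
    (hNd : N + 3 ≤ 2 * d) :
    (∀ (n : ℕ) (P : C(GaugeConfig d (2 * Q) (Matrix.specialUnitaryGroup (Fin N) ℂ), ℝ)),
        ∫ U, P U ∂(wilsonMeasure (fundamentalRep (Fin N)) β) ∈ linkCutLevelValuesSuN N β k n P) ↔
      0 ≤ β := by
  rw [← TiltedRP.cubicTorus_linkRP_suN_iff_of_odd hQ k hN h3 hNd β,
    ← reflectionPositiveOn_midReflect_iff (fundamentalRep (Fin N)) β k]
  exact (rpCuts_sound_iff_suN
    (measurePreserving_midReflectCM_wilson (fundamentalRep (Fin N)) (continuous_fundamentalRep _) hQ k β)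
    (midReflectCM_midReflectCM hQ k) (fun _ hg => comp_midReflectCM_mem_polyAlgebra _ k hg)).symm

/-- ★★★ **At every `β < 0` the word-level `SU(N)` SDP with link cuts is INFEASIBLE at all large
levels, for every objective** (`N` odd, `3 ≤ N`, `N + 3 ≤ 2d`; `(ℤ/2Q)^d`, `Q ≥ 2`; any axis).
[folklore] -/
theorem linkCutLevelValues_eventually_eq_empty_suOdd (hQ : 2 ≤ Q) (k : Fin d) (hN : Odd N) (h3 : 3 ≤ N)
    (hNd : N + 3 ≤ 2 * d) (hβ : β < 0)
    (P : C(GaugeConfig d (2 * Q) (Matrix.specialUnitaryGroup (Fin N) ℂ), ℝ)) :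
    ∀ᶠ n in atTop, linkCutLevelValuesSuN N β k n P = ∅ := by
  refine rpCutLevelValues_eventually_eq_empty_suN
    (measurePreserving_midReflectCM_wilson (fundamentalRep (Fin N)) (continuous_fundamentalRep _) hQ k β)
    (midReflectCM_midReflectCM hQ k) (fun _ hg => comp_midReflectCM_mem_polyAlgebra _ k hg) ?_ P
  rw [reflectionPositiveOn_midReflect_iff (fundamentalRep (Fin N)) β k]
  exact TiltedRP.not_cubicTorus_linkRP_suN_of_odd hQ k hN h3 hNd hβ

/-- ★★★ **At every `β < 0` EVERY solution of the untruncated `SU(N)` torus bootstrap violates a link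
cut** (`N` odd, `3 ≤ N`, `N + 3 ≤ 2d`): some polynomial observable `f` of the closed half
`{1 ≤ x_k ≤ Q}` has `φ ((f ∘ Θ_k) · f) < 0`. [folklore] -/
theorem exists_linkCut_neg_of_bootstrap_suOdd (hQ : 2 ≤ Q) (k : Fin d) (hN : Odd N) (h3 : 3 ≤ N)
    (hNd : N + 3 ≤ 2 * d) (hβ : β < 0)
    {φ : C(GaugeConfig d (2 * Q) (Matrix.specialUnitaryGroup (Fin N) ℂ), ℝ) →ₗ[ℝ] ℝ} (h1 : φ 1 = 1)
    (hpos : ∀ a ∈ polyAlgebra (ι := Edge d (2 * Q)) (fundamentalLatticeRep N), 0 ≤ φ (a * a))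
    (hφ : IsSDFunctional (fundamentalLatticeRep N) (suExp N) (fun _ => wilsonAction (fundamentalRep (Fin N))) β φ) :
    ∃ f ∈ polyAlgebra (ι := Edge d (2 * Q)) (fundamentalLatticeRep N),
      IsMidObservable (cubicUnit d (2 * Q)) Q (cubicAxisCoord d (2 * Q) k) (⇑f) ∧
        φ (f.comp (midReflectCM k) * f) < 0 := by
  have hRP : ¬ ReflectionPositiveOn (wilsonMeasure (d := d) (L := 2 * Q) (fundamentalRep (Fin N)) β)
      (midReflectCM k) (midHalfLinks Q k) := by
    rw [reflectionPositiveOn_midReflect_iff (fundamentalRep (Fin N)) β k]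
    exact TiltedRP.not_cubicTorus_linkRP_suN_of_odd hQ k hN h3 hNd hβ
  obtain ⟨f, hf, hfS, hneg⟩ := exists_rpCut_neg_of_bootstrap_suN
    (measurePreserving_midReflectCM_wilson (fundamentalRep (Fin N)) (continuous_fundamentalRep _) hQ k β)
    (midReflectCM_midReflectCM hQ k) (fun _ hg => comp_midReflectCM_mem_polyAlgebra _ k hg) hRP h1 hpos hφ
  exact ⟨f, hf, (isMidObservable_iff_dependsOn Q k _).2 hfS, hneg⟩

/-! ### `SU(3)` in `d ≥ 3` -/

/-- ★★★ **`SU(3)`, `d ≥ 3`, `(ℤ/2Q)^d`, `Q ≥ 2`, any axis: the link cuts are consistent with the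
torus bootstrap IFF `0 ≤ β`.** [folklore] -/
theorem linkCuts_sound_iff_su3 (hQ : 2 ≤ Q) (k : Fin d) (hd : 3 ≤ d) :
    (∀ (n : ℕ) (P : C(GaugeConfig d (2 * Q) (Matrix.specialUnitaryGroup (Fin 3) ℂ), ℝ)),
        ∫ U, P U ∂(wilsonMeasure (fundamentalRep (Fin 3)) β) ∈ linkCutLevelValuesSuN 3 β k n P) ↔
      0 ≤ β :=
  linkCuts_sound_iff_suOdd β hQ k (by decide) le_rfl (by omega)

/-- ★★★ **`SU(3)`, `d ≥ 3`, every `β < 0`: the word-level SDP with link cuts is eventually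
INFEASIBLE for every objective.** [folklore] -/
theorem linkCutLevelValues_eventually_eq_empty_su3 (hQ : 2 ≤ Q) (k : Fin d) (hd : 3 ≤ d) (hβ : β < 0)
    (P : C(GaugeConfig d (2 * Q) (Matrix.specialUnitaryGroup (Fin 3) ℂ), ℝ)) :
    ∀ᶠ n in atTop, linkCutLevelValuesSuN 3 β k n P = ∅ :=
  linkCutLevelValues_eventually_eq_empty_suOdd β hQ k (by decide) le_rfl (by omega) hβ P

/-- ★★★ **`SU(3)`, `d ≥ 3`, every `β < 0`: every solution of the untruncated torus bootstrap
violates a link cut.** [folklore] -/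
theorem exists_linkCut_neg_of_bootstrap_su3 (hQ : 2 ≤ Q) (k : Fin d) (hd : 3 ≤ d) (hβ : β < 0)
    {φ : C(GaugeConfig d (2 * Q) (Matrix.specialUnitaryGroup (Fin 3) ℂ), ℝ) →ₗ[ℝ] ℝ} (h1 : φ 1 = 1)
    (hpos : ∀ a ∈ polyAlgebra (ι := Edge d (2 * Q)) (fundamentalLatticeRep 3), 0 ≤ φ (a * a))
    (hφ : IsSDFunctional (fundamentalLatticeRep 3) (suExp 3) (fun _ => wilsonAction (fundamentalRep (Fin 3))) β φ) :
    ∃ f ∈ polyAlgebra (ι := Edge d (2 * Q)) (fundamentalLatticeRep 3),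
      IsMidObservable (cubicUnit d (2 * Q)) Q (cubicAxisCoord d (2 * Q) k) (⇑f) ∧
        φ (f.comp (midReflectCM k) * f) < 0 :=
  exists_linkCut_neg_of_bootstrap_suOdd β hQ k (by decide) le_rfl (by omega) hβ h1 hpos hφ

/-- ★★★ **In the vocabulary of `BootstrapLinkReflectionPositivity`** (time axis, tree `Θ`,
`IsPositiveTimeObservable`): for `SU(3)` on `(ℤ/2Q)^d`, `d ≥ 3`, `Q ≥ 2`, the link-RP cut SDP
`linkRpLevelValuesSuN` keeps the Wilson value feasible at every level for every observable IFF
`0 ≤ β` (`wilson_mem_linkRpLevelValues_suN` was the direction `⇐`). [folklore] -/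
theorem linkRpCuts_sound_iff_su3 (hQ : 2 ≤ Q) (hd : 3 ≤ d) :
    haveI : NeZero d := ⟨by omega⟩
    (∀ (n : ℕ) (P : C(GaugeConfig d (2 * Q) (Matrix.specialUnitaryGroup (Fin 3) ℂ), ℝ)),
        ∫ U, P U ∂(wilsonMeasure (fundamentalRep (Fin 3)) β) ∈
          linkRpLevelValuesSuN (d := d) (L := 2 * Q) 3 β n P) ↔ 0 ≤ β := by
  haveI : NeZero d := ⟨by omega⟩
  simp only [linkRpLevelValuesSuN_eq]
  exact linkCuts_sound_iff_su3 β hQ 0 hd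

/-- ★★ **The contrast at negative coupling** (`SU(3)`, `d ≥ 3`, `(ℤ/2Q)^d`, `Q ≥ 2`, `β < 0`): the
SITE-reflection cuts keep the Wilson value feasible at every level (`wilson_mem_rpLevelValues_suN`,
every real `β`) while the LINK-reflection cuts are eventually infeasible. [folklore] -/
theorem siteCuts_sound_linkCuts_infeasible_su3 (hQ : 2 ≤ Q) (k : Fin d) (hd : 3 ≤ d) (hβ : β < 0)
    (P : C(GaugeConfig d (2 * Q) (Matrix.specialUnitaryGroup (Fin 3) ℂ), ℝ)) :
    haveI : NeZero d := ⟨by omega⟩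
    (∀ n, ∫ U, P U ∂(wilsonMeasure (fundamentalRep (Fin 3)) β) ∈ rpLevelValuesSuN (d := d) (L := 2 * Q) 3 β n P) ∧
      ∀ᶠ n in atTop, linkCutLevelValuesSuN 3 β k n P = ∅ := by
  haveI : NeZero d := ⟨by omega⟩
  exact ⟨fun n => wilson_mem_rpLevelValues_suN 3 β (even_two_mul Q) n P,
    linkCutLevelValues_eventually_eq_empty_su3 β hQ k hd hβ P⟩

end Unitary

end Summit.QuantumFields.GaugeBoot

end
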